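import Summits.AtomisticToContinuum.Crystallization.Theorems.ExcessDecayLiouvilleHcpLiouvilleGeometry

/-!
# `ExcessDecayLiouville.HcpLiouville` (stmt-AtomisticToContinuum-9332), line `Sketch`, level 1: the cut-off and its kernel energy

Helper for stub `stub_levelOneGrowth` of the line `two-level-caccioppoli` (crux `HcpLiouville`).  Over the
site set `S = Sites₀ t A` of an admissible hcp datum (`Adm₀ A`, `Inner₀ t A`) we define the Lipschitz
cut-off `χ = LevelOne.cutoff S c R` (`1` on `B_R(c)`, `0` off `B_{2R}(c)` and off `S`, slope `1/R`) and
bound the **kernel energy of the cut-off**, the quantity that controls the right-hand side of the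
nonlinear Caccioppoli inequality:

* `LevelOne.K₀` — the row-sum constant of the dominating kernel `k(p,q) = 248064·|p − q|⁻⁸`
  (`sum_ker_le_K₀`, `sum_ker_far_le_K₀ : Σ_{dist ≥ R} ≤ K₀/R⁵`, `sum_distSq_mul_ker_le_K₀`);
* `LevelOne.tsum_weight_le` — a row of the weight `(χ p − χ q)²·k(p,q)` sums to `≤ 2K₀/R²`
  (near part by the Lipschitz bound and `Σ dist²·k ≤ K₀`, far part `≤ K₀/R⁵`);
* `LevelOne.tsum_weight_far_le` — a row at a centre `p` with `dist p c > 3R` only sees the finitely many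
  sites of `B_{2R}(c)`, all at distance `≥ R`;
* `LevelOne.sum_tsum_weight_le` — hence `Σ_p Σ_q (χ p − χ q)² k(p,q) ≤ 1984·K₀·R` for `R ≥ 1`
  (`#(S ∩ B_r) ≤ 32 r³`): the Caccioppoli gain `R³·R⁻² = R`.

All `[folklore]`; a `--supports` helper file for item stmt-AtomisticToContinuum-9332, nothing here closes
an item.
-/

noncomputable section

namespace Summit.AtomisticToContinuum.Crystallization.Theorems.ExcessDecayLiouville

open scoped BigOperators Topology Classical InnerProductSpace
open Literature.MathematicalPhysics.StatisticalMechanics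
open Summit.AtomisticToContinuum.Crystallization.Theses.ExcessDecayLiouville
open Summit.AtomisticToContinuum.Crystallization.Theorems.PhononStabilityNegative

local notation "E3" => EuclideanSpace ℝ (Fin 3)

namespace LevelOne

variable {t : Fin 2 → E3} {A : E3 →L[ℝ] E3}

/-! ## The kernel constant -/

/-- **The kernel constant** `K₀ = 248064·1024/(23/25)⁸`, a common bound for the row sums of `k`. [folklore] -/
def K₀ : ℝ := 248064 * (1024 / ((23 / 25 : ℝ) ^ 3 * (23 / 25 : ℝ) ^ 5))

/-- `K₀ > 0`. [folklore] -/
theorem K₀_pos : 0 < K₀ := by unfold K₀; positivity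

/-- Row sums of the kernel are `≤ K₀` (finite form). [folklore] -/
theorem sum_ker_le_K₀ (hA : Adm₀ A) (hI : Inner₀ t A) {p : E3} (hp : p ∈ Sites₀ t A) (F : Finset (Sites₀ t A)) :
    ∑ q ∈ F, ker p q ≤ K₀ :=
  sum_ker_le hA hI hp F

/-- Row sums of the kernel are `≤ K₀` (`tsum` form). [folklore] -/
theorem tsum_ker_le_K₀ (hA : Adm₀ A) (hI : Inner₀ t A) {p : E3} (hp : p ∈ Sites₀ t A) :
    ∑' q : Sites₀ t A, ker p q ≤ K₀ :=
  tsum_ker_le hA hI hp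

/-- Far part of a kernel row: `Σ_{q ∈ F, dist ≥ R} k(p,q) ≤ K₀/R⁵` for `R ≥ 1` and any centre `p`. [folklore] -/
theorem sum_ker_far_le_K₀ (hA : Adm₀ A) (hI : Inner₀ t A) (p : E3) {R : ℝ} (hR : 1 ≤ R)
    (F : Finset (Sites₀ t A)) :
    ∑ q ∈ F, (if R ≤ dist (q : E3) p then ker p q else 0) ≤ K₀ / R ^ 5 := by
  refine (sum_ker_far_le hA hI p (by linarith) F).trans ?_
  unfold K₀
  have hR5 : 0 < R ^ 5 := by positivity
  have hc : (0 : ℝ) < (23 / 25 : ℝ) ^ 3 := by positivity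
  have hc5 : (0 : ℝ) < (23 / 25 : ℝ) ^ 5 := by positivity
  have hc5' : (23 / 25 : ℝ) ^ 5 ≤ 1 := pow_le_one₀ (by norm_num) (by norm_num)
  rw [le_div_iff₀ hR5]
  have h1 : 1024 / ((23 / 25 : ℝ) ^ 3 * R ^ 5) * R ^ 5 = 1024 / (23 / 25 : ℝ) ^ 3 := by
    field_simp
  calc 248064 * (1024 / ((23 / 25 : ℝ) ^ 3 * R ^ 5)) * R ^ 5 = 248064 * (1024 / (23 / 25 : ℝ) ^ 3) := by
        rw [mul_assoc, h1]
    _ ≤ 248064 * (1024 / ((23 / 25 : ℝ) ^ 3 * (23 / 25 : ℝ) ^ 5)) := by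
        gcongr
        calc (23 / 25 : ℝ) ^ 3 * (23 / 25 : ℝ) ^ 5 ≤ (23 / 25 : ℝ) ^ 3 * 1 := by gcongr
          _ = (23 / 25 : ℝ) ^ 3 := mul_one _

/-- `Σ_{q ∈ F} dist(p,q)²·k(p,q) ≤ K₀` at a site `p`. [folklore] -/
theorem sum_distSq_mul_ker_le_K₀ (hA : Adm₀ A) (hI : Inner₀ t A) {p : E3} (hp : p ∈ Sites₀ t A)
    (F : Finset (Sites₀ t A)) : ∑ q ∈ F, dist (q : E3) p ^ 2 * ker p q ≤ K₀ := by
  refine (sum_distSq_mul_ker_le hA hI hp F).trans ?_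
  unfold K₀
  norm_num

/-! ## The cut-off -/

/-- **The cut-off** `χ(p) = max(0, min(1, 2 − dist(p,c)/R))` on `S`, `0` off `S`. [folklore] -/
def cutoff (S : Set E3) (c : E3) (R : ℝ) (p : E3) : ℝ :=
  if p ∈ S then max 0 (min 1 (2 - dist p c / R)) else 0

variable {S : Set E3} {c : E3} {R : ℝ}

/-- `0 ≤ χ`. [folklore] -/
theorem cutoff_nonneg (S : Set E3) (c : E3) (R : ℝ) (p : E3) : 0 ≤ cutoff S c R p := by
  unfold cutoff; split_ifs
  · exact le_max_left _ _
  · exact le_rfl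

/-- `χ ≤ 1`. [folklore] -/
theorem cutoff_le_one (S : Set E3) (c : E3) (R : ℝ) (p : E3) : cutoff S c R p ≤ 1 := by
  unfold cutoff; split_ifs
  · exact max_le zero_le_one (min_le_left _ _)
  · exact zero_le_one

/-- `χ = 0` off `S`. [folklore] -/
theorem cutoff_of_not_mem {p : E3} (h : p ∉ S) : cutoff S c R p = 0 := by
  unfold cutoff; rw [if_neg h]

/-- `χ = 1` on `S ∩ B_R(c)`. [folklore] -/
theorem cutoff_eq_one (hR : 0 < R) {p : E3} (hp : p ∈ S) (h : dist p c ≤ R) : cutoff S c R p = 1 := by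
  unfold cutoff
  rw [if_pos hp]
  have h1 : 1 ≤ 2 - dist p c / R := by
    have : dist p c / R ≤ 1 := by rw [div_le_one hR]; exact h
    linarith
  rw [min_eq_left h1, max_eq_right zero_le_one]

/-- `χ = 0` off `B_{2R}(c)`. [folklore] -/
theorem cutoff_eq_zero_of_le (hR : 0 < R) {p : E3} (h : 2 * R ≤ dist p c) : cutoff S c R p = 0 := by
  unfold cutoff
  split_ifs
  · have h1 : 2 - dist p c / R ≤ 0 := by
      have : 2 ≤ dist p c / R := by rw [le_div_iff₀ hR]; exact h
      linarith
    rw [min_eq_right (by linarith), max_eq_left h1]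
  · rfl

/-- If `χ p ≠ 0` then `p ∈ S` and `dist p c < 2R`. [folklore] -/
theorem mem_of_cutoff_ne_zero (hR : 0 < R) {p : E3} (h : cutoff S c R p ≠ 0) : p ∈ S ∧ dist p c < 2 * R := by
  by_contra hcon
  rw [not_and_or] at hcon
  rcases hcon with h1 | h1
  · exact h (cutoff_of_not_mem h1)
  · exact h (cutoff_eq_zero_of_le hR (not_lt.1 h1))

/-- **Lipschitz bound**: `|χ p − χ q| ≤ dist(p,q)/R` on `S`. [folklore] -/
theorem abs_cutoff_sub_le (hR : 0 < R) {p q : E3} (hp : p ∈ S) (hq : q ∈ S) :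
    |cutoff S c R p - cutoff S c R q| ≤ dist p q / R := by
  unfold cutoff
  rw [if_pos hp, if_pos hq]
  have h1 := abs_max_sub_max_le_max (0 : ℝ) (min 1 (2 - dist p c / R)) 0 (min 1 (2 - dist q c / R))
  have h2 := abs_min_sub_min_le_max (1 : ℝ) (2 - dist p c / R) 1 (2 - dist q c / R)
  simp only [sub_self, abs_zero] at h1 h2
  have h3 : |2 - dist p c / R - (2 - dist q c / R)| ≤ dist p q / R := by
    rw [show (2 : ℝ) - dist p c / R - (2 - dist q c / R) = (dist q c - dist p c) / R by ring, abs_div,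
      abs_of_pos hR]
    exact div_le_div_of_nonneg_right (by rw [dist_comm p q]; exact abs_dist_sub_le q p c) hR.le
  have h0 : (0 : ℝ) ≤ dist p q / R := by positivity
  calc |max 0 (min 1 (2 - dist p c / R)) - max 0 (min 1 (2 - dist q c / R))|
      ≤ max 0 |min 1 (2 - dist p c / R) - min 1 (2 - dist q c / R)| := h1
    _ ≤ max 0 (max 0 |2 - dist p c / R - (2 - dist q c / R)|) := by gcongr
    _ ≤ dist p q / R := max_le h0 (max_le h0 h3)

/-- `(χ p − χ q)² ≤ 1`. [folklore] -/
theorem sq_cutoff_sub_le_one (S : Set E3) (c : E3) (R : ℝ) (p q : E3) :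
    (cutoff S c R p - cutoff S c R q) ^ 2 ≤ 1 := by
  have h1 := cutoff_nonneg S c R p
  have h2 := cutoff_le_one S c R p
  have h3 := cutoff_nonneg S c R q
  have h4 := cutoff_le_one S c R q
  nlinarith

/-- `(χ p − χ q)² ≤ dist(p,q)²/R²` on `S`. [folklore] -/
theorem sq_cutoff_sub_le (hR : 0 < R) {p q : E3} (hp : p ∈ S) (hq : q ∈ S) :
    (cutoff S c R p - cutoff S c R q) ^ 2 ≤ dist p q ^ 2 / R ^ 2 := by
  rw [← sq_abs, ← div_pow]
  exact pow_le_pow_left₀ (abs_nonneg _) (abs_cutoff_sub_le hR hp hq) 2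

/-! ## The kernel energy of the cut-off -/

/-- A weight row is summable (dominated by the kernel row). [folklore] -/
theorem summable_weight (hA : Adm₀ A) (hI : Inner₀ t A) (c : E3) (R : ℝ) {p : E3} (hp : p ∈ Sites₀ t A) :
    Summable fun q : Sites₀ t A => (cutoff (Sites₀ t A) c R p - cutoff (Sites₀ t A) c R q) ^ 2 * ker p q := by
  refine (summable_ker hA hI hp).of_nonneg_of_le (fun q => mul_nonneg (sq_nonneg _) (ker_nonneg _ _)) fun q => ?_
  calc (cutoff (Sites₀ t A) c R p - cutoff (Sites₀ t A) c R q) ^ 2 * ker p q ≤ 1 * ker p q :=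
        mul_le_mul_of_nonneg_right (sq_cutoff_sub_le_one _ c R p q) (ker_nonneg _ _)
    _ = ker p q := one_mul _

/-- A weight row sums to `≤ K₀`. [folklore] -/
theorem tsum_weight_le_K₀ (hA : Adm₀ A) (hI : Inner₀ t A) (c : E3) (R : ℝ) {p : E3} (hp : p ∈ Sites₀ t A) :
    ∑' q : Sites₀ t A, (cutoff (Sites₀ t A) c R p - cutoff (Sites₀ t A) c R q) ^ 2 * ker p q ≤ K₀ := by
  refine tsum_le_of_sum_le' K₀_pos.le fun F => (Finset.sum_le_sum fun q _ => ?_).trans (sum_ker_le_K₀ hA hI hp F)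
  calc (cutoff (Sites₀ t A) c R p - cutoff (Sites₀ t A) c R q) ^ 2 * ker p q ≤ 1 * ker p q :=
        mul_le_mul_of_nonneg_right (sq_cutoff_sub_le_one _ c R p q) (ker_nonneg _ _)
    _ = ker p q := one_mul _

/-- **A weight row sums to `≤ 2K₀/R²`** (`R ≥ 1`): near part `Σ dist²k/R² ≤ K₀/R²`, far part `≤ K₀/R⁵`.
[folklore] -/
theorem sum_weight_le (hA : Adm₀ A) (hI : Inner₀ t A) (c : E3) {R : ℝ} (hR : 1 ≤ R) {p : E3}
    (hp : p ∈ Sites₀ t A) (F : Finset (Sites₀ t A)) :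
    ∑ q ∈ F, (cutoff (Sites₀ t A) c R p - cutoff (Sites₀ t A) c R q) ^ 2 * ker p q ≤ 2 * K₀ / R ^ 2 := by
  have hR0 : 0 < R := by linarith
  have hpt : ∀ q : Sites₀ t A, (cutoff (Sites₀ t A) c R p - cutoff (Sites₀ t A) c R q) ^ 2 * ker p q ≤
      dist (q : E3) p ^ 2 * ker p q / R ^ 2 + (if R ≤ dist (q : E3) p then ker p q else 0) := by
    intro q
    have hk := ker_nonneg p q
    by_cases h : R ≤ dist (q : E3) p
    · rw [if_pos h]
      have h1 := sq_cutoff_sub_le_one (Sites₀ t A) c R p q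
      have h2 : 0 ≤ dist (q : E3) p ^ 2 * ker p q / R ^ 2 := by positivity
      nlinarith
    · rw [if_neg h, add_zero]
      have h1 := sq_cutoff_sub_le (S := Sites₀ t A) (c := c) hR0 hp q.2
      calc (cutoff (Sites₀ t A) c R p - cutoff (Sites₀ t A) c R q) ^ 2 * ker p q
          ≤ dist p q ^ 2 / R ^ 2 * ker p q := mul_le_mul_of_nonneg_right h1 hk
        _ = dist (q : E3) p ^ 2 * ker p q / R ^ 2 := by rw [dist_comm]; ring
  have hfar := sum_ker_far_le_K₀ hA hI p hR F
  have hnear := sum_distSq_mul_ker_le_K₀ hA hI hp F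
  have h5 : K₀ / R ^ 5 ≤ K₀ / R ^ 2 :=
    div_le_div_of_nonneg_left K₀_pos.le (by positivity) (pow_le_pow_right₀ hR (by norm_num))
  calc ∑ q ∈ F, (cutoff (Sites₀ t A) c R p - cutoff (Sites₀ t A) c R q) ^ 2 * ker p q
      ≤ ∑ q ∈ F, (dist (q : E3) p ^ 2 * ker p q / R ^ 2 + (if R ≤ dist (q : E3) p then ker p q else 0)) :=
        Finset.sum_le_sum fun q _ => hpt q
    _ = (∑ q ∈ F, dist (q : E3) p ^ 2 * ker p q) / R ^ 2 +
          ∑ q ∈ F, (if R ≤ dist (q : E3) p then ker p q else 0) := by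
        rw [Finset.sum_add_distrib, Finset.sum_div]
    _ ≤ K₀ / R ^ 2 + K₀ / R ^ 5 := add_le_add (div_le_div_of_nonneg_right hnear (by positivity)) hfar
    _ ≤ 2 * K₀ / R ^ 2 := by
        have h6 : 2 * K₀ / R ^ 2 = K₀ / R ^ 2 + K₀ / R ^ 2 := by ring
        linarith

/-- The `tsum` form of `sum_weight_le`. [folklore] -/
theorem tsum_weight_le (hA : Adm₀ A) (hI : Inner₀ t A) (c : E3) {R : ℝ} (hR : 1 ≤ R) {p : E3}
    (hp : p ∈ Sites₀ t A) :
    ∑' q : Sites₀ t A, (cutoff (Sites₀ t A) c R p - cutoff (Sites₀ t A) c R q) ^ 2 * ker p q ≤ 2 * K₀ / R ^ 2 :=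
  tsum_le_of_sum_le' (by have := K₀_pos; positivity) (sum_weight_le hA hI c hR hp)

/-- **Far rows see only the ball**: for `dist p c > 3R` the weight row is bounded by the kernel over the
finitely many sites of `B_{2R}(c)`, all at distance `≥ R` from `p` (finite form). [folklore] -/
theorem sum_weight_far_le (hA : Adm₀ A) (hI : Inner₀ t A) (c : E3) {R : ℝ} (hR : 0 < R) {p : E3}
    (hpc : 3 * R < dist p c) (F : Finset (Sites₀ t A)) :
    ∑ q ∈ F, (cutoff (Sites₀ t A) c R p - cutoff (Sites₀ t A) c R q) ^ 2 * ker p q ≤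
      ∑ q ∈ (finite_sites_ball hA hI c (2 * R)).toFinset, (if R ≤ dist p (q : E3) then ker (q : E3) p else 0) := by
  set P := (finite_sites_ball hA hI c (2 * R)).toFinset with hP
  have hmemP : ∀ q : Sites₀ t A, q ∈ P ↔ dist (q : E3) c ≤ 2 * R := fun q => by
    rw [hP, Set.Finite.mem_toFinset]; rfl
  have hχp : cutoff (Sites₀ t A) c R p = 0 := cutoff_eq_zero_of_le hR (by linarith)
  have hfarq : ∀ q : Sites₀ t A, q ∈ P → R ≤ dist p (q : E3) := by
    intro q hq
    have := (hmemP q).1 hq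
    have := dist_triangle p (q : E3) c
    linarith
  calc ∑ q ∈ F, (cutoff (Sites₀ t A) c R p - cutoff (Sites₀ t A) c R q) ^ 2 * ker p q
      = ∑ q ∈ F, (if q ∈ P then cutoff (Sites₀ t A) c R q ^ 2 * ker p q else 0) := by
        refine Finset.sum_congr rfl fun q _ => ?_
        split_ifs with hq
        · rw [hχp, zero_sub, neg_sq]
        · have : cutoff (Sites₀ t A) c R q = 0 :=
            cutoff_eq_zero_of_le hR (le_of_lt (not_le.1 fun h => hq ((hmemP q).2 h)))
          rw [hχp, this]; ring
    _ = ∑ q ∈ F.filter (· ∈ P), cutoff (Sites₀ t A) c R q ^ 2 * ker p q := (Finset.sum_filter _ _).symm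
    _ ≤ ∑ q ∈ F.filter (· ∈ P), (if R ≤ dist p (q : E3) then ker (q : E3) p else 0) := by
        refine Finset.sum_le_sum fun q hq => ?_
        have hqP : q ∈ P := (Finset.mem_filter.1 hq).2
        rw [if_pos (hfarq q hqP), ker_comm (q : E3) p]
        have h1 : cutoff (Sites₀ t A) c R q ^ 2 ≤ 1 := by
          have := cutoff_nonneg (Sites₀ t A) c R q
          have := cutoff_le_one (Sites₀ t A) c R q
          nlinarith
        calc cutoff (Sites₀ t A) c R q ^ 2 * ker p q ≤ 1 * ker p q :=
            mul_le_mul_of_nonneg_right h1 (ker_nonneg _ _)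
          _ = ker p q := one_mul _
    _ ≤ ∑ q ∈ P, (if R ≤ dist p (q : E3) then ker (q : E3) p else 0) := by
        refine Finset.sum_le_sum_of_subset_of_nonneg (fun q hq => (Finset.mem_filter.1 hq).2) ?_
        intro q _ _
        split_ifs
        · exact ker_nonneg _ _
        · exact le_rfl

/-- The `tsum` form of `sum_weight_far_le`. [folklore] -/
theorem tsum_weight_far_le (hA : Adm₀ A) (hI : Inner₀ t A) (c : E3) {R : ℝ} (hR : 0 < R) {p : E3}
    (hpc : 3 * R < dist p c) :
    ∑' q : Sites₀ t A, (cutoff (Sites₀ t A) c R p - cutoff (Sites₀ t A) c R q) ^ 2 * ker p q ≤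
      ∑ q ∈ (finite_sites_ball hA hI c (2 * R)).toFinset, (if R ≤ dist p (q : E3) then ker (q : E3) p else 0) :=
  tsum_le_of_sum_le' (Finset.sum_nonneg fun q _ => by split_ifs; exacts [ker_nonneg _ _, le_rfl])
    (sum_weight_far_le hA hI c hR hpc)

/-- **Kernel energy of the cut-off**: `Σ_{p ∈ F} Σ_q (χ p − χ q)² k(p,q) ≤ 1984·K₀·R` for every finite set
`F` of sites and `R ≥ 1` (`≤ 32(3R)³` rows of size `2K₀/R²`, plus `≤ 32(2R)³` columns of size `K₀/R⁵`).
[folklore] -/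
theorem sum_tsum_weight_le (hA : Adm₀ A) (hI : Inner₀ t A) (c : E3) {R : ℝ} (hR : 1 ≤ R)
    (F : Finset (Sites₀ t A)) :
    ∑ p ∈ F, ∑' q : Sites₀ t A, (cutoff (Sites₀ t A) c R p - cutoff (Sites₀ t A) c R q) ^ 2 * ker p q ≤
      1984 * K₀ * R := by
  have hR0 : 0 < R := by linarith
  have hK := K₀_pos
  set P := (finite_sites_ball hA hI c (2 * R)).toFinset with hP
  have hmemP : ∀ q : Sites₀ t A, q ∈ P ↔ dist (q : E3) c ≤ 2 * R := fun q => by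
    rw [hP, Set.Finite.mem_toFinset]; rfl
  set w : Sites₀ t A → ℝ := fun p => ∑' q : Sites₀ t A,
    (cutoff (Sites₀ t A) c R p - cutoff (Sites₀ t A) c R q) ^ 2 * ker p q with hw
  rw [← Finset.sum_filter_add_sum_filter_not F (fun p : Sites₀ t A => dist (p : E3) c ≤ 3 * R)]
  -- near rows
  have hnear : ∑ p ∈ F.filter (fun p : Sites₀ t A => dist (p : E3) c ≤ 3 * R), w p ≤ 32 * (3 * R) ^ 3 * (2 * K₀ / R ^ 2) := by
    have h1 : ∑ p ∈ F.filter (fun p : Sites₀ t A => dist (p : E3) c ≤ 3 * R), w p ≤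
        (F.filter (fun p : Sites₀ t A => dist (p : E3) c ≤ 3 * R)).card • (2 * K₀ / R ^ 2) :=
      Finset.sum_le_card_nsmul _ _ _ fun p _ => tsum_weight_le hA hI c hR p.2
    rw [nsmul_eq_mul] at h1
    have hcard : ((F.filter (fun p : Sites₀ t A => dist (p : E3) c ≤ 3 * R)).card : ℝ) ≤ 32 * (3 * R) ^ 3 :=
      card_sites_le hA hI c (by linarith) _ fun q hq => (Finset.mem_filter.1 hq).2
    have h0 : 0 ≤ 2 * K₀ / R ^ 2 := by positivity
    nlinarith
  -- far rows
  have hfar : ∑ p ∈ F.filter (fun p : Sites₀ t A => ¬ dist (p : E3) c ≤ 3 * R), w p ≤ 32 * (2 * R) ^ 3 * (K₀ / R ^ 5) := by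
    calc ∑ p ∈ F.filter (fun p : Sites₀ t A => ¬ dist (p : E3) c ≤ 3 * R), w p
        ≤ ∑ p ∈ F.filter (fun p : Sites₀ t A => ¬ dist (p : E3) c ≤ 3 * R),
            ∑ q ∈ P, (if R ≤ dist (p : E3) (q : E3) then ker (q : E3) p else 0) :=
          Finset.sum_le_sum fun p hp =>
            tsum_weight_far_le hA hI c hR0 (not_le.1 (Finset.mem_filter.1 hp).2)
      _ = ∑ q ∈ P, ∑ p ∈ F.filter (fun p : Sites₀ t A => ¬ dist (p : E3) c ≤ 3 * R),
            (if R ≤ dist (p : E3) (q : E3) then ker (q : E3) p else 0) := Finset.sum_comm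
      _ ≤ ∑ q ∈ P, K₀ / R ^ 5 := Finset.sum_le_sum fun q _ => sum_ker_far_le_K₀ hA hI (q : E3) hR _
      _ = P.card * (K₀ / R ^ 5) := by rw [Finset.sum_const, nsmul_eq_mul]
      _ ≤ 32 * (2 * R) ^ 3 * (K₀ / R ^ 5) := by
          have hcard : (P.card : ℝ) ≤ 32 * (2 * R) ^ 3 :=
            card_sites_le hA hI c (by linarith) P fun q hq => (hmemP q).1 hq
          have h0 : 0 ≤ K₀ / R ^ 5 := by positivity
          nlinarith
  -- arithmetic
  have h1 : 32 * (3 * R) ^ 3 * (2 * K₀ / R ^ 2) = 1728 * K₀ * R := by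
    field_simp
    ring
  have h2 : 32 * (2 * R) ^ 3 * (K₀ / R ^ 5) = 256 * K₀ / R ^ 2 := by
    field_simp
    ring
  have h3 : 256 * K₀ / R ^ 2 ≤ 256 * K₀ * R := by
    rw [div_le_iff₀ (by positivity)]
    have : (1 : ℝ) ≤ R * R ^ 2 := by nlinarith
    nlinarith
  rw [h1] at hnear
  rw [h2] at hfar
  linarith

end LevelOne

/-- Registered sub-goal carrying this helper file (crux stmt-AtomisticToContinuum-9332, line `Sketch`, level 1):
the kernel energy of the cut-off grows linearly in the radius. [folklore] -/
theorem levelOne_cutoff : ∀ (t : Fin 2 → E3) (A : E3 →L[ℝ] E3), Adm₀ A → Inner₀ t A → ∀ (c : E3) (R : ℝ), 1 ≤ R → ∀ F : Finset (Sites₀ t A), ∑ p ∈ F, ∑' q : Sites₀ t A, (LevelOne.cutoff (Sites₀ t A) c R p - LevelOne.cutoff (Sites₀ t A) c R q) ^ 2 * LevelOne.ker p q ≤ 1984 * LevelOne.K₀ * R := by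
  intro t A hA hI c R hR F
  exact LevelOne.sum_tsum_weight_le hA hI c hR F

end Summit.AtomisticToContinuum.Crystallization.Theorems.ExcessDecayLiouville

end
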